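import Mathlib

/-!
# `GrenetZeon.DualUnipotentThreeHalves` (stmt-ValiantsHypothesis-24318) — P-Q1 kernel port (Q1 «ι(7) ≤ 19», lead-g2 `Q1-PROOF.md`), Level 1:
# THE THREE PATH COUNTS (L1.c / L1.d) AS ONE LEMMA — `(Z^s)_{0,s−1} = u_{t−1}·w_t` for the bordered shift `Z = A + e_∞ wᵀ + u e_∞ᵀ`

Experiment cell «val-heavytop-census» (D-0160), engine seat val-htc-eng-1 (g3), kit 0; director R340 (3) «P-Q1 port: eng lineage; eng-1 g3 takes the
next piece».  Companion of eng-2 g3's Level-1 bricks ✓ `…HeavyTopPencilFirstOrder` (p688831), ✓ `…HeavyTopTorusInitial` (p689195),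
`…HeavyTopBorderOrthogonality` (p689547) and in THEIR conventions: ambient `Matrix (Fin (s+1)) (Fin (s+1)) ℂ`, border index `∞ := Fin.last s`,
row border `vecMulVec (Pi.single ∞ 1) w = e_∞ wᵀ`, column border `vecMulVec u (Pi.single ∞ 1) = u e_∞ᵀ`.  (Lead's 1-indexed `s'`, `J_{s'−1} ⊕ 0`,
`(Z^{s'−1})_{1,s'−1} = u_t w_{t+1}` become, with `s' = s + 1` and 0-indexing, `(Z^s)_{0,s−1} = u_{t−1} w_t`.)

WHAT Q1-PROOF §1 NEEDS.  After the border-torus degeneration, `V_μ ∋ A := J ⊕ 0` (the shift `A e_{i+1} = e_i` on the block `e_0 … e_{s−1}`),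
`V⁺ ⊂` column `∞` (rows `< s`), `V⁻ ⊂` row `∞`, and every `Z ∈ V_μ` has `Z^s = 0` (generic type `(s,1)`).  Three times the lead argues «the only
`Z`-path of length `s` from `e_{s−1}` to `e_0` is `e_{s−1} →A…A→ e_t →w→ e_∞ →u→ e_{t−1} →A…A→ e_0`, so `(Z^s)_{0,s−1} = u_{t−1} w_t ≠ 0`»:
(L1.c) `u = e_{t−1}`, `w = e_t` (case (i) is empty); (L1.d) shape `(t−1, s−t)`: general `u` with `u_{t−1} ≠ 0`, `w = e_t`; shape `(t, s−1−t)`: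
`u = e_{t−1}`, general `w`, read as `w_t = 0`.  All three are instances of ONE identity, proved here WITHOUT path enumeration:

* `pow_apply_strictUpper` — for a STRICTLY UPPER triangular `M ∈ M_n(ℂ)` with superdiagonal `d`: `(M^k)_{i,j} = 0` for `j < i + k` and
  `(M^k)_{i,i+k} = ∏_{l<k} d(i+l)` (induction on `k`); `pow_apply_zero_last_strictUpper` — the corner `(M^n)_{0,n} = ∏_{l<n} d l` in `M_{n+1}`;
  `submatrix_pow` — powers commute with reindexing.
* ★★ `border_pow_apply` — for `1 ≤ t`, `t + 1 ≤ s`, `u` supported on rows `< t`, `w` on block columns `≥ t` (`w_∞ = 0`):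
  `((A + e_∞wᵀ + u e_∞ᵀ)^s)_{0,s−1} = u_{t−1} · w_t`.  PROOF: in the basis order `e_0,…,e_{t−1}, e_∞, e_t,…,e_{s−1}` the matrix is strictly upper
  triangular with superdiagonal `(1,…,1, u_{t−1}, w_t, 1,…,1)` (an explicit `Equiv` on `Fin (s+1)` and a nine-case entry check), then the corner formula.
* ★ `border_pow_ne_zero` (`u_{t−1} w_t ≠ 0 ⇒ Z^s ≠ 0`), and the three uses by name: `border_single_single_pow_ne_zero` (L1.c),
  `border_col_single_pow_ne_zero` (L1.d first shape), `border_single_row_pow_apply` (L1.d second shape: `(Z^s)_{0,s−1} = w_t`).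

The shift is taken ABSTRACTLY through its entries (`hA : A i j = if j = i+1 ∧ j < s then 1 else 0`), so the assembly may instantiate it with whatever
concrete `J ⊕ 0` it fixes.  Pure matrix algebra; nothing here is a statement about nilpotent SUBSPACES, ι(7), (5,7), R2 or 24318 (all OPEN / not
moved); VP ≠ VNP NOT proved.  `--supports stmt-ValiantsHypothesis-24318 --as helper`.  No definitions, no named facts.
[lead-g2 `Q1-PROOF.md` §1 (L1.c)/(L1.d) = crux `CENSUS-Q1-PROOF.md`; eng-2 g3 INBOX 02:28:12Z (conventions, «what Level 1 still needs»); this seat]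
-/

set_option linter.dupNamespace false
set_option autoImplicit false

namespace Summit.ValiantsHypothesis.ValiantsHypothesis.Theorems.GrenetZeon.HeavyTopBorderPathCount

open Matrix
open scoped BigOperators

/-! ## §1 Powers of a strictly upper triangular matrix: zero below the `k`-th superdiagonal, the superdiagonal product on it -/

/-- **Superdiagonal product formula.**  For a strictly upper triangular `M` (entries `(i,j)` with `j ≤ i` vanish) whose superdiagonal is
`M_{i,i+1} = d i`: `(M^k)_{i,j} = 0` for `j < i + k` and `(M^k)_{i,i+k} = ∏_{l<k} d (i+l)`.  (One directed path of each length along the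
superdiagonal; reusable for the one-path words of Q1-PROOF §1–§2.) [folklore] -/
theorem pow_apply_strictUpper {n : ℕ} (M : Matrix (Fin n) (Fin n) ℂ) (d : ℕ → ℂ) (hM : ∀ i j : Fin n, (j : ℕ) ≤ i → M i j = 0)
    (hd : ∀ i j : Fin n, (j : ℕ) = i + 1 → M i j = d i) (k : ℕ) :
    ∀ i j : Fin n, ((j : ℕ) < i + k → (M ^ k) i j = 0) ∧ ((j : ℕ) = i + k → (M ^ k) i j = ∏ l ∈ Finset.range k, d (i + l)) := by
  induction k with
  | zero =>
    intro i j
    refine ⟨fun h => ?_, fun h => ?_⟩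
    · rw [pow_zero, Matrix.one_apply_ne]
      exact fun hij => by rw [hij] at h; omega
    · have hij : i = j := Fin.ext (by omega)
      rw [pow_zero, hij, Matrix.one_apply_eq, Finset.prod_range_zero]
  | succ k ih =>
    intro i j
    rw [pow_succ, Matrix.mul_apply]
    refine ⟨fun h => ?_, fun h => ?_⟩
    · refine Finset.sum_eq_zero fun l _ => ?_
      by_cases hl : (l : ℕ) < i + k
      · rw [(ih i l).1 hl, zero_mul]
      · rw [hM l j (by omega), mul_zero]
    · have hlk : i + k < n := by have := j.isLt; omega
      rw [Finset.sum_eq_single ⟨i + k, hlk⟩]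
      · rw [(ih i ⟨i + k, hlk⟩).2 rfl, hd ⟨i + k, hlk⟩ j (by simp [h]; omega), Finset.prod_range_succ]
      · intro l _ hl
        by_cases hl' : (l : ℕ) < i + k
        · rw [(ih i l).1 hl', zero_mul]
        · have : (l : ℕ) ≠ i + k := fun e => hl (Fin.ext e)
          rw [hM l j (by omega), mul_zero]
      · intro h'
        exact absurd (Finset.mem_univ _) h'

/-- The corner entry: for a strictly upper triangular `M ∈ M_{n+1}`, `(M^n)_{0,n} = ∏_{l<n} d l`. [folklore] -/
theorem pow_apply_zero_last_strictUpper {n : ℕ} (M : Matrix (Fin (n + 1)) (Fin (n + 1)) ℂ) (d : ℕ → ℂ)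
    (hM : ∀ i j : Fin (n + 1), (j : ℕ) ≤ i → M i j = 0) (hd : ∀ i j : Fin (n + 1), (j : ℕ) = i + 1 → M i j = d i) :
    (M ^ n) 0 (Fin.last n) = ∏ l ∈ Finset.range n, d l := by
  have h := ((pow_apply_strictUpper M d hM hd n) 0 (Fin.last n)).2 (by simp)
  simpa using h

/-- Powers commute with reindexing along an equivalence. [folklore] -/
theorem submatrix_pow {n : ℕ} (M : Matrix (Fin n) (Fin n) ℂ) (e : Fin n ≃ Fin n) (k : ℕ) :
    (M.submatrix e e) ^ k = (M ^ k).submatrix e e := by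
  induction k with
  | zero => rw [pow_zero, pow_zero, Matrix.submatrix_one_equiv]
  | succ k ih => rw [pow_succ, ih, Matrix.submatrix_mul_equiv, ← pow_succ]

/-! ## §2 The bordered shift: moving the border index to position `t` makes it strictly upper triangular -/

section Border

variable {s t : ℕ}

/-- **THE PATH COUNT** (Q1-PROOF (L1.c)/(L1.d), 0-indexed, size-free).  In `M_{s+1}(ℂ)` with border index `∞ = Fin.last s`, let
`A` be the shift on the block (`A_{i,i+1} = 1` for `i + 1 < s`, all other entries `0`; so `A e_{i+1} = e_i` on `e_0,…,e_{s−1}` and `A` kills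
`e_0, e_∞`), let the column border `u` be supported on rows `< t` and the row border `w` on block columns `≥ t` (`1 ≤ t`, `t + 1 ≤ s`).  Then for
`Z = A + e_∞ wᵀ + u e_∞ᵀ`:  `(Z^s)_{0, s−1} = u_{t−1} · w_t`.
Proof: in the basis order `e_0,…,e_{t−1}, e_∞, e_t,…,e_{s−1}` the matrix `Z` is strictly upper triangular with superdiagonal
`(1,…,1, u_{t−1}, w_t, 1,…,1)`, and ✓ `pow_apply_zero_last_strictUpper` applies (the unique `Z`-path of length `s` from `e_{s−1}` to `e_0` is
`e_{s−1} →A⋯A→ e_t →w→ e_∞ →u→ e_{t−1} →A⋯A→ e_0`). [lead-g2 Q1-PROOF §1; this file] -/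
theorem border_pow_apply (ht : 1 ≤ t) (hts : t + 1 ≤ s) (A : Matrix (Fin (s + 1)) (Fin (s + 1)) ℂ)
    (hA : ∀ i j : Fin (s + 1), A i j = if (j : ℕ) = i + 1 ∧ (j : ℕ) < s then 1 else 0)
    (u w : Fin (s + 1) → ℂ) (hu : ∀ i : Fin (s + 1), t ≤ (i : ℕ) → u i = 0) (hw : ∀ j : Fin (s + 1), (j : ℕ) < t → w j = 0)
    (hw' : w (Fin.last s) = 0) :
    ((A + vecMulVec (Pi.single (Fin.last s) 1) w + vecMulVec u (Pi.single (Fin.last s) 1)) ^ s) 0 ⟨s - 1, by omega⟩ =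
      u ⟨t - 1, by omega⟩ * w ⟨t, by omega⟩ := by
  classical
  set Z := A + vecMulVec (Pi.single (Fin.last s) 1) w + vecMulVec u (Pi.single (Fin.last s) 1) with hZ
  -- entries of `Z`
  have hZe : ∀ i j : Fin (s + 1), Z i j = (if (j : ℕ) = i + 1 ∧ (j : ℕ) < s then 1 else 0) +
      (if i = Fin.last s then w j else 0) + (if j = Fin.last s then u i else 0) := by
    intro i j
    simp only [hZ, Matrix.add_apply, vecMulVec_apply, Pi.single_apply, hA i j]
    split_ifs <;> ring
  -- the new basis order: `σ p` = the old index sitting at new position `p`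
  let g : Fin (s + 1) → Fin (s + 1) := fun p =>
    if (p : ℕ) < t then p else if (p : ℕ) = t then Fin.last s else ⟨(p : ℕ) - 1, by omega⟩
  let f : Fin (s + 1) → Fin (s + 1) := fun i =>
    if (i : ℕ) < t then i else if h : (i : ℕ) = s then ⟨t, by omega⟩ else ⟨(i : ℕ) + 1, by have := i.isLt; omega⟩
  have hg : ∀ p : Fin (s + 1), ((p : ℕ) < t ∧ (g p : ℕ) = p) ∨ ((p : ℕ) = t ∧ (g p : ℕ) = s) ∨
      (t < (p : ℕ) ∧ (g p : ℕ) = p - 1) := by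
    intro p
    simp only [g]
    split_ifs with h1 h2
    · exact Or.inl ⟨h1, rfl⟩
    · exact Or.inr (Or.inl ⟨h2, rfl⟩)
    · exact Or.inr (Or.inr ⟨by omega, rfl⟩)
  have hf : ∀ i : Fin (s + 1), ((i : ℕ) < t ∧ (f i : ℕ) = i) ∨ ((i : ℕ) = s ∧ (f i : ℕ) = t) ∨
      (t ≤ (i : ℕ) ∧ (i : ℕ) < s ∧ (f i : ℕ) = i + 1) := by
    intro i
    have := i.isLt
    simp only [f]
    split_ifs with h1 h2
    · exact Or.inl ⟨h1, rfl⟩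
    · exact Or.inr (Or.inl ⟨h2, rfl⟩)
    · exact Or.inr (Or.inr ⟨by omega, by omega, rfl⟩)
  let σ : Fin (s + 1) ≃ Fin (s + 1) :=
    { toFun := g
      invFun := f
      left_inv := fun p => Fin.ext (by
        have := p.isLt
        rcases hg p with ⟨h1, h2⟩ | ⟨h1, h2⟩ | ⟨h1, h2⟩ <;>
          rcases hf (g p) with ⟨h3, h4⟩ | ⟨h3, h4⟩ | ⟨h3, h4, h5⟩ <;> omega)
      right_inv := fun i => Fin.ext (by
        have := i.isLt
        rcases hf i with ⟨h1, h2⟩ | ⟨h1, h2⟩ | ⟨h1, h2, h2'⟩ <;>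
          rcases hg (f i) with ⟨h3, h4⟩ | ⟨h3, h4⟩ | ⟨h3, h4⟩ <;> omega) }
  have hσ : ∀ p, σ p = g p := fun p => rfl
  -- the reindexed matrix and its superdiagonal
  set M := Z.submatrix σ σ with hM
  let d : ℕ → ℂ := fun l => if l + 1 = t then u ⟨t - 1, by omega⟩ else if l = t then w ⟨t, by omega⟩ else 1
  have hlast : ∀ i : Fin (s + 1), i = Fin.last s ↔ (i : ℕ) = s := fun i => by
    constructor
    · rintro rfl; rfl
    · intro h; exact Fin.ext h
  have hMlow : ∀ p p' : Fin (s + 1), (p' : ℕ) ≤ p → M p p' = 0 := by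
    intro p p' hpp
    have hp := p.isLt; have hp' := p'.isLt
    rw [hM, Matrix.submatrix_apply, hZe, hσ, hσ]
    have e1 : ¬ (((g p' : Fin (s + 1)) : ℕ) = (g p : ℕ) + 1 ∧ ((g p' : Fin (s + 1)) : ℕ) < s) := by
      rcases hg p with ⟨h1, h2⟩ | ⟨h1, h2⟩ | ⟨h1, h2⟩ <;> rcases hg p' with ⟨h3, h4⟩ | ⟨h3, h4⟩ | ⟨h3, h4⟩ <;> omega
    rw [if_neg e1, zero_add]
    have e2 : (if g p = Fin.last s then w (g p') else 0) = 0 := by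
      split_ifs with h
      · rw [hlast] at h
        by_cases h' : ((g p' : Fin (s + 1)) : ℕ) < t
        · exact hw _ h'
        · have : ((g p' : Fin (s + 1)) : ℕ) = s := by
            rcases hg p with ⟨h1, h2⟩ | ⟨h1, h2⟩ | ⟨h1, h2⟩ <;> rcases hg p' with ⟨h3, h4⟩ | ⟨h3, h4⟩ | ⟨h3, h4⟩ <;> omega
          rw [← hlast] at this
          rw [this, hw']
      · rfl
    have e3 : (if g p' = Fin.last s then u (g p) else 0) = 0 := by
      split_ifs with h
      · rw [hlast] at h
        exact hu _ (by rcases hg p with ⟨h1, h2⟩ | ⟨h1, h2⟩ | ⟨h1, h2⟩ <;> rcases hg p' with ⟨h3, h4⟩ | ⟨h3, h4⟩ | ⟨h3, h4⟩ <;> omega)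
      · rfl
    rw [e2, e3, add_zero]
  have hMsup : ∀ p p' : Fin (s + 1), (p' : ℕ) = p + 1 → M p p' = d p := by
    intro p p' hpp
    have hp := p.isLt; have hp' := p'.isLt
    rw [hM, Matrix.submatrix_apply, hZe, hσ, hσ]
    simp only [d]
    rcases hg p with ⟨h1, h2⟩ | ⟨h1, h2⟩ | ⟨h1, h2⟩ <;> rcases hg p' with ⟨h3, h4⟩ | ⟨h3, h4⟩ | ⟨h3, h4⟩ <;>
      (try (exfalso; omega))
    · -- p, p' < t : an `A`-step inside the first block
      have a1 : ¬ g p = Fin.last s := by rw [hlast]; omega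
      have a2 : ¬ g p' = Fin.last s := by rw [hlast]; omega
      rw [if_pos (by omega), if_neg a1, if_neg a2, if_neg (by omega), if_neg (by omega)]; ring
    · -- p = t − 1, p' = t : the step `e_∞ → e_{t−1}` carries `u_{t−1}`
      have a1 : ¬ g p = Fin.last s := by rw [hlast]; omega
      have a2 : g p' = Fin.last s := by rw [hlast]; omega
      have a3 : g p = ⟨t - 1, by omega⟩ := Fin.ext (by simp only; omega)
      rw [if_neg (by omega), if_neg a1, if_pos a2, if_pos (by omega), a3]; ring
    · -- p = t, p' = t + 1 : the step `e_t → e_∞` carries `w_t`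
      have a1 : g p = Fin.last s := by rw [hlast]; omega
      have a2 : ¬ g p' = Fin.last s := by rw [hlast]; omega
      have a3 : g p' = ⟨t, by omega⟩ := Fin.ext (by simp only; omega)
      rw [if_neg (by omega), if_pos a1, if_neg a2, if_neg (by omega), if_pos (by omega), a3]; ring
    · -- p, p' > t : an `A`-step inside the second block
      have a1 : ¬ g p = Fin.last s := by rw [hlast]; omega
      have a2 : ¬ g p' = Fin.last s := by rw [hlast]; omega
      rw [if_pos (by omega), if_neg a1, if_neg a2, if_neg (by omega), if_neg (by omega)]; ring
  -- the corner entry of `M^s`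
  have hcorner := pow_apply_zero_last_strictUpper M d hMlow hMsup
  have hprod : ∏ l ∈ Finset.range s, d l = u ⟨t - 1, by omega⟩ * w ⟨t, by omega⟩ := by
    have hd2 : ∀ l, d l = (if l = t - 1 then u ⟨t - 1, by omega⟩ else 1) * (if l = t then w ⟨t, by omega⟩ else 1) := by
      intro l
      simp only [d]
      split_ifs <;> first | (exfalso; omega) | ring
    simp_rw [hd2]
    rw [Finset.prod_mul_distrib, Finset.prod_ite_eq', Finset.prod_ite_eq', if_pos (Finset.mem_range.2 (by omega)),
      if_pos (Finset.mem_range.2 (by omega))]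
  -- back to `Z`
  have h0 : σ 0 = 0 := Fin.ext (by
    show ((g 0 : Fin (s + 1)) : ℕ) = 0
    rcases hg 0 with ⟨h1, h2⟩ | ⟨h1, h2⟩ | ⟨h1, h2⟩
    · exact h2
    · exact absurd h1 (by simp; omega)
    · exact absurd h1 (by simp)
    )
  have hl : σ (Fin.last s) = ⟨s - 1, by omega⟩ := Fin.ext (by
    show ((g (Fin.last s) : Fin (s + 1)) : ℕ) = s - 1
    have hls : ((Fin.last s : Fin (s + 1)) : ℕ) = s := rfl
    rcases hg (Fin.last s) with ⟨h1, h2⟩ | ⟨h1, h2⟩ | ⟨h1, h2⟩ <;> omega)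
  rw [hM, submatrix_pow, Matrix.submatrix_apply, h0, hl] at hcorner
  rw [hcorner, hprod]

/-- **Corollary: full nilindex.**  Under the hypotheses of `border_pow_apply`, if `u_{t−1}·w_t ≠ 0` then `Z^s ≠ 0` — `Z` has nilindex `s + 1`,
so it cannot lie in a space on which `Z^s = 0` (the generic-type-`(s,1)` constraint of Q1-PROOF §0–§1). [this file] -/
theorem border_pow_ne_zero (ht : 1 ≤ t) (hts : t + 1 ≤ s) (A : Matrix (Fin (s + 1)) (Fin (s + 1)) ℂ)
    (hA : ∀ i j : Fin (s + 1), A i j = if (j : ℕ) = i + 1 ∧ (j : ℕ) < s then 1 else 0)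
    (u w : Fin (s + 1) → ℂ) (hu : ∀ i : Fin (s + 1), t ≤ (i : ℕ) → u i = 0) (hw : ∀ j : Fin (s + 1), (j : ℕ) < t → w j = 0)
    (hw' : w (Fin.last s) = 0) (hne : u ⟨t - 1, by omega⟩ * w ⟨t, by omega⟩ ≠ 0) :
    (A + vecMulVec (Pi.single (Fin.last s) 1) w + vecMulVec u (Pi.single (Fin.last s) 1)) ^ s ≠ 0 := by
  intro h
  have h2 := border_pow_apply ht hts A hA u w hu hw hw'
  rw [h, Matrix.zero_apply] at h2
  exact hne h2.symm

/-- **(L1.c)**: border `u = e_{t−1}`, `w = e_t` — `(Z^s)_{0,s−1} = 1`, so `Z^s ≠ 0` (case (i) of Q1-PROOF Level 1 is empty). [this file] -/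
theorem border_single_single_pow_ne_zero (ht : 1 ≤ t) (hts : t + 1 ≤ s) (A : Matrix (Fin (s + 1)) (Fin (s + 1)) ℂ)
    (hA : ∀ i j : Fin (s + 1), A i j = if (j : ℕ) = i + 1 ∧ (j : ℕ) < s then 1 else 0) :
    (A + vecMulVec (Pi.single (Fin.last s) 1) (Pi.single (⟨t, by omega⟩ : Fin (s + 1)) (1 : ℂ)) +
        vecMulVec (Pi.single (⟨t - 1, by omega⟩ : Fin (s + 1)) (1 : ℂ)) (Pi.single (Fin.last s) 1)) ^ s ≠ 0 := by
  refine border_pow_ne_zero ht hts A hA _ _ (fun i hi => ?_) (fun j hj => ?_) ?_ ?_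
  · rw [Pi.single_apply, if_neg]
    exact fun h => by rw [h] at hi; simp at hi; omega
  · rw [Pi.single_apply, if_neg]
    exact fun h => by rw [h] at hj; simp at hj
  · rw [Pi.single_apply, if_neg]
    exact fun h => by rw [Fin.ext_iff] at h; simp at h; omega
  · simp

/-- **(L1.d), shape `(t−1, s−t)`**: general column border `u` supported on rows `< t` with `u_{t−1} ≠ 0`, row border `w = e_t` ⇒ `Z^s ≠ 0`.
[this file] -/
theorem border_col_single_pow_ne_zero (ht : 1 ≤ t) (hts : t + 1 ≤ s) (A : Matrix (Fin (s + 1)) (Fin (s + 1)) ℂ)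
    (hA : ∀ i j : Fin (s + 1), A i j = if (j : ℕ) = i + 1 ∧ (j : ℕ) < s then 1 else 0) (u : Fin (s + 1) → ℂ)
    (hu : ∀ i : Fin (s + 1), t ≤ (i : ℕ) → u i = 0) (hut : u ⟨t - 1, by omega⟩ ≠ 0) :
    (A + vecMulVec (Pi.single (Fin.last s) 1) (Pi.single (⟨t, by omega⟩ : Fin (s + 1)) (1 : ℂ)) +
        vecMulVec u (Pi.single (Fin.last s) 1)) ^ s ≠ 0 := by
  refine border_pow_ne_zero ht hts A hA _ _ hu (fun j hj => ?_) ?_ ?_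
  · rw [Pi.single_apply, if_neg]
    exact fun h => by rw [h] at hj; simp at hj
  · rw [Pi.single_apply, if_neg]
    exact fun h => by rw [Fin.ext_iff] at h; simp at h; omega
  · simpa using hut

/-- **(L1.d), shape `(t, s−1−t)`**: column border `u = e_{t−1}`, general row border `w` supported on block columns `≥ t` ⇒
`(Z^s)_{0,s−1} = w_t`; so `Z^s = 0` forces `w_t = 0`. [this file] -/
theorem border_single_row_pow_apply (ht : 1 ≤ t) (hts : t + 1 ≤ s) (A : Matrix (Fin (s + 1)) (Fin (s + 1)) ℂ)
    (hA : ∀ i j : Fin (s + 1), A i j = if (j : ℕ) = i + 1 ∧ (j : ℕ) < s then 1 else 0) (w : Fin (s + 1) → ℂ)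
    (hw : ∀ j : Fin (s + 1), (j : ℕ) < t → w j = 0) (hw' : w (Fin.last s) = 0) :
    ((A + vecMulVec (Pi.single (Fin.last s) 1) w +
        vecMulVec (Pi.single (⟨t - 1, by omega⟩ : Fin (s + 1)) (1 : ℂ)) (Pi.single (Fin.last s) 1)) ^ s) 0 ⟨s - 1, by omega⟩ =
      w ⟨t, by omega⟩ := by
  rw [border_pow_apply ht hts A hA _ w (fun i hi => ?_) hw hw']
  · simp
  · rw [Pi.single_apply, if_neg]
    exact fun h => by rw [h] at hi; simp at hi; omega

end Border

end Summit.ValiantsHypothesis.ValiantsHypothesis.Theorems.GrenetZeon.HeavyTopBorderPathCount
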